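import Literature.MathematicalPhysics.QuantumFieldTheory.Balaban1983to89.B10LargeFieldSum

/-!
# `Balaban1985CMP102.SectD` — T. Bałaban, *Ultraviolet stability of three-dimensional lattice pure gauge field
# theories*, Commun. Math. Phys. **102** (1985) 255–275 [Balaban1985UV3], **Sect. D «Concluding Remarks», pp. 272–274,
# displays (64)–(71) and the inference «(41), (47) imply Theorem 1», AS PRINTED** (lane `pub-balaban3d`, spine typer 2;
# statements only; ONE new display `Ineq66` — the bound «of the form (41) with the expression (66) in the exponential» —
# with its [folklore] bookkeeping from (41); everything else RE-USED from the tree by `export`)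

HONEST FRAMING (PLAN.md §0 of the lane, binding).  As in the sibling `…Balaban1985CMP102.SectC`: (5) p. 256 / Thm 1 p. 257
for the d = 3 Wilson lattice pure Yang–Mills densities on a finite torus; NOT a continuum limit, NOT infinite volume, NOT a
mass gap, NOT d = 4, NOT Clay.  RECORDED NEGATIVE KNOWLEDGE carried by name (PLAN §0.4; cell pub-balaban GAPS G-B10-01):
the vacuum-energy term (62) contains `d(𝔤) log g_k |T₁^{(k)*}|`, so the «O(1)» of (65)/(66)/(5) is affine in |log g_k| —
the LITERAL Thm 1 (`B10.Thm1Printed`, one O(1) for all g_k in a bounded set) is kernel-false on the paper's own leaf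
system (`B10DagLeaf.not_thm1Printed_of_leafSystems`); the compact-window reading `B10.Thm1PrintedCompact` is what Sect. D
proves (`B10.thm1Compact_of_thm2`, `B10Assembly.thm1Compact_and_thm2_of_leafSystem`).  Nothing printed is asserted here.

PRIMARY TEXT.  PDF `paper:balaban1985-cmp102-uv-stability-3d` (journal page = PDF page + 254); tokens «…» read by this
seat on the renders `…/b2b-balaban-ref1/pages/1985-cmp102-uv-stability-3d/1985-cmp102-uv-stability-3d-p018,p019,p020-x2.png`
(pp. 272–274) as images; «Lnn» = printed text line of the journal page.  Misprints ⟦sic: …⟧: (65) «Σ_{k=k}^{K−1}» ⟦j = k⟧;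
(68) «p(q_j)» ⟦p(g_j)⟧; (69) the constant is printed with the glyph «0(1)» ⟦O(1)⟧; p. 274 L2 «the second term in (65)» ⟦(66)⟧.

THE PRINTED TEXT OF SECT. D (pp. 272 L38–274 L3), display by display, with the tree decl that types / certifies it
(LQB = `Literature.MathematicalPhysics.QuantumFieldTheory.Balaban1983to89`; all RE-USED, §0):
* p. 272 L38–40 «We have to show that the inequalities (41), (47) imply Theorem 1, i.e. the inequalities (5). Let us
  consider the upper bound (41). We estimate the interaction terms using the bounds (44)–(46) by O(1)M₁³g²_{k−1}p²(g_{k−1})|Λ_k|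
  ≤ O(1)|T₁^{(k)}|.» — `B10.Bound46Printed`, `B10.Pint_le_of_bound46`, `B10.gsq_psq_le` (the d = 3 input g²p(g)² = O(1)).
* **(64)** p. 273 L1–2 «E_k = Σ_{j=k}^{K−1} E^{(j)}, where E^{(j)} is defined by (62).» — `B10.Ek` (+ `Ek_zero`, `Ek_succ`,
  `Ek_top`), carrier clause `B10.TowerRun.Ecst_eq`.
* **(65)** p. 273 L3–5 «From (25), which holds for arbitrary j, we get easily |E^{(j)}| ≤ O(1)|T₁^{(j)}|, hence
  |E_k| ≤ Σ_{k=k}^{K−1} ⟦j=k⟧ O(1)|T₁^{(j)}| = Σ_{j=k}^{K−1} O(1)L^{−3(j−k)}|T₁^{(k)}| ≤ O(1)|T₁^{(k)}|.» — `B10.Estep62_abs_le`,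
  `B10.Ek_abs_le`, `B10.Ecst_abs_le`, `B10.Ecst_abs_le_window` (O(1) affine in |log g_k|: G-B10-01), per-scale input from
  (25) `B10Eq65PolymerSum.estep62_abs_le_of_bound25` / `estep62_abs_le_discharged`.
* **(66)** p. 273 L6–8 «We obtain a bound of the form (41) with the expression
  −(1/g_k²)A^η(U_k) + Σ_{j=0}^{k−1} O(log g_j^{−1})|Z_j| + O(1)|T₁^{(k)}|, in the exponential.» — NEW here: `Ineq66`
  (+ [folklore] `ineq66_of_41`); inside LQB it is the unnamed middle step of `B10.upper5_of_41`.
* **(67)–(68)** p. 273 L8–13 «To prove the inequality (5) we have to produce all small factors connected with large fields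
  regions P in the functions ζ_{Λ_j}. Let us take a plaquette p′ ⊂ Λ_j and such that |V_j(∂p′) − 1| ≥ g_jp(g_j). We have
  (67) Ū_k^j = V_j on Λ_j, and the configuration U_k satisfies the following regularity condition on B^j(Λ_j). (68)
  |U_k(∂p) − 1| < O(1)g_jp(q_j)L^{−2j} ⟦p(g_j)⟧.» — `B10Eq69Local.eq69_local` hypotheses, `B10Eq44AvgRegularity`.
* **(69)** p. 273 L14–18 «Applying the inequalities (50), (53) [4], we have (69) |Ū_k^j(∂p′) − 1| < Σ_{x∈B^j(x₀)} L^{−3j}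
  Σ_{p⊂(p′)_x} |U_k(∂p) − 1| + O(1)(g_jp(g_j))² ⟦glyph printed «0(1)»⟧, where p′ = ⟨x₀, y₀, z₀, w₀⟩, (p′)_x denotes the plaquette p′ transported
  parallelly to the point x, i.e. the lower left corner coincides with the point x.» — `B10Eq69Concrete`, `B10Eq69Iteration`,
  `B10Eq69Local.ineq69_blockSum` (binder b7: [4] (50) p. 25, (53) p. 26 = `B7Prop1Explicit`, `B7Eq50Linear`).
* **(70)** p. 273 L19–23 «Squaring both sides of the above inequality and using (67) yields (70) |V_j(∂p′) − 1|² <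
  Σ_{x∈B^j(x₀)} L^{−j} Σ_{p⊂(p′)_x} |U_k(∂p) − 1|² + O(1)(g_jp(g_j))³ ≤ 2 Σ_{p⊂Δ′} L^j[1 − Re tr U_k(∂p)] + O(1)(g_jp(g_j))³,
  where Δ′ = B^j(x₀) ∪ B^j(y₀) ∪ B^j(z₀) ∪ B^j(w₀).» — `B10.eq70_sq_step`, `B10Eq70Squaring`, `B10Eq70Concrete`.
* **(71)** p. 273 L24–27 «This inequality can be written finally as (71) (1/g_k²) Σ_{p⊂Δ′} η^{−1}[1 − Re tr U_k(∂p)] ≥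
  (1/2g_j²)|V_j(∂p′) − 1|² − O(1)g_jp³(g_j) ≥ ½p²(g_j) − O(1)g_jp³(g_j) ≥ ¼p²(g_j) for g_j sufficiently small.» —
  `B10.eq71_arith`, `B10Eq71Concrete.smallFactor_concrete` / `smallFactor_specialUnitary`.
* p. 273 L27–p. 274 L3 «Thus the part of the action 1/g_k²A^η(U_k) localized to the sum of four j-blocks Δ′ connected with
  the plaquette p′ can be bounded from below by 1/4p²(g_j), and the corresponding part of the exponential gives the small
  factor exp(−1/4p²(g_j)). We get these small factors for all plaquettes in all large fields set P. Results related to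
  stability bound (70) have been obtained by P. Federbush in [17, 18]. The analysis of Sect. 3.C [9], which is model
  independent, show that these small factors are enough to control all sums in (41), together with the second term in (65)
  ⟦(66)⟧. This gives the upper bound in (5). The lower bound is simpler, it is enough to use (44)–(46) and (66). Thus we have
  completed the proof of Theorem 1.» — `B10.LargeFieldControlPrinted` (the leaf), `B10LargeField.LargeFieldControlVia9`,
  `B10LargeFieldSum.largeFieldControl_of_resummation(_gRun)` (binder [9] §3.C = LQB `B2.Claim342Printed`);
  the assembly `B10.upper5_of_41`, `B10.lower5_of_47`, `B10.bounds5At_of_ineqs`, `B10.thm1Compact_of_thm2`.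
[cite: Balaban1985UV3, Sect. D pp.272–274]
-/

namespace Literature.MathematicalPhysics.QuantumFieldTheory.Balaban1985CMP102.SectD

open Literature.MathematicalPhysics.QuantumFieldTheory.Balaban1983to89
open Literature.MathematicalPhysics.QuantumFieldTheory.Balaban1983to89.B10 (TowerRun RunData Ineq41)

/-! ## §0 Theorem 2 (lane ruling R-THM: its home is the head of this file) and the RE-USE rows (no restatement) -/

/-- **Theorem 2**, p. 272 = PDF 18 L35–37, verbatim (render p018-x2): «Thus we have proved. **Theorem 2.** The sequence of
densities ρ_k defined by the inductive equations (2), with ρ₀ given by (1), satisfies the inequalities (41), (47).» —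
BY NAME the tree's `B10.Thm2Printed` (family form over `B10.RunData`: for every run i and every k ≤ K, «ρ_k satisfies
(41), (47)» = `Ineq41_47 k`, bound to the typed shapes `B10.Ineq41`/`B10.Ineq47` by `B10.SpecOK`); an `abbrev`, not a
restatement (lane rule).  Its printed proof = Sect. A (k = 0 → 1) + Sect. C (k → k + 1): `B10.thm2_of_sections`,
`B10SectAGathering.thm2_of_leaves`; the Sect. C displays are in the sibling `…Balaban1985CMP102.SectC`.
[cite: Balaban1985UV3, Thm 2 p.272] -/
abbrev Thm2AsPrinted {I : Type} (runs : I → RunData) : Prop := B10.Thm2Printed runs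

export Literature.MathematicalPhysics.QuantumFieldTheory.Balaban1983to89.B10
  (Bound46Printed Pint_le_of_bound46 gsq_psq_le Ek Ek_zero Ek_succ Ek_top Estep62_abs_le Ek_abs_le Ecst_abs_le
    Ecst_abs_le_window LargeFieldControlPrinted eq70_sq_step eq71_arith upper5_of_41 lower5_of_47 bounds5At_of_ineqs
    thm1Compact_of_thm2 Thm1OfThm2Leaf Thm1PrintedCompact Bounds5At)
export Literature.MathematicalPhysics.QuantumFieldTheory.Balaban1983to89.B10LargeField (LargeFieldControlVia9)
export Literature.MathematicalPhysics.QuantumFieldTheory.Balaban1983to89.B10LargeFieldSum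
  (HistModel SmallFactorsAll largeFieldControl_of_resummation largeFieldControl_of_resummation_gRun)

/-! ## §1 (66) as a display -/

variable {T : TowerRun}

/-- **(66)**, p. 273 = PDF 19 L6–8, verbatim: «We obtain a bound of the form (41) with the expression (66)
−(1/g_k²)A^η(U_k) + Σ_{j=0}^{k−1} O(log g_j^{−1})|Z_j| + O(1)|T₁^{(k)}|, in the exponential.» — over LQB's carrier
`B10.TowerRun` (the history functional `T.LF k` of (41), the main term `T.mainT k h U` = (1/g_k²)A^η(U_k), the Z-terms
`T.Zterm k h` = Σ_{j<k} O(log g_j^{−1})|Z_j|, the volume `T.sites k` = |T₁^{(k)}|); the «O(1)» is the explicit real `C`.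
Reached in print from (41) by the first lines of Sect. D (interaction terms ≤ O(1)|T₁^{(k)}| by (44)–(46), |E_k| ≤
O(1)|T₁^{(k)}| by (65), the remainders Σ_j O((L^jε)^{3+κ₀})|T₁^{(j)}| ≤ O(1)|T₁^{(k)}|): `ineq66_of_41`.  The constant C is
affine in |log g_k| through (65) (G-B10-01).  Hypothesis-shaped. [cite: Balaban1985UV3, (66) p.273] -/
def Ineq66 (T : TowerRun) (k : ℕ) (C : ℝ) : Prop :=
  ∀ U : T.Cfg k, T.ρ k U ≤ T.LF k U (fun h => -(T.mainT k h U) + T.Zterm k h + C * T.sites k)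

/-- [folklore] bookkeeping, kernel-checked (the three sentences of p. 272 L39–p. 273 L6): (41)_k with
|Σ_jΣ_{Y_j}𝒫_j| ≤ a|T₁^{(k)}|, |E_k| ≤ b|T₁^{(k)}| and Σ_{j<k} O((L^jε)^{3+κ₀})|T₁^{(j)}| ≤ c|T₁^{(k)}| gives (66) with
O(1) = a + b + c (monotonicity of the history functional, `T.lf_mono`).  The same step is performed inside LQB's
`B10.upper5_of_41`; here it is exposed because (66) is a printed display. [cite: Balaban1985UV3, (66) p.273] -/
theorem ineq66_of_41 (k : ℕ) {a b c : ℝ} (h41 : Ineq41 T k)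
    (hP : ∀ (h : T.Hist k) (U : T.Cfg k), |T.Pint k h U| ≤ a * T.sites k)
    (hE : |T.Ecst k| ≤ b * T.sites k) (hR : T.Rm k ≤ c * T.sites k) :
    Ineq66 T k (a + b + c) := by
  intro U
  refine (h41 U).trans (T.lf_mono k U _ _ fun h => ?_)
  have h1 := (abs_le.mp (hP h U)).2
  have h2 := (abs_le.mp hE).1
  linarith

/-- [folklore] bookkeeping, kernel-checked (p. 273 L8–p. 274 L3): (66) together with the large-field control «these small
factors are enough to control all sums in (41), together with the second term in (66)» in the shape of LQB's leaf
(`T.LF k U (−mainT + Zterm) ≤ exp(d|T₁^{(k)}|)`, cf. `B10.LargeFieldControlPrinted`) gives the upper bound of (5) at step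
k with O(1) = C + d (`T.lf_shift`: LF(F + t) = eᵗ·LF(F)). [cite: Balaban1985UV3, (66) p.273, (5) p.256] -/
theorem upper5_of_ineq66 (k : ℕ) {C d : ℝ} (h66 : Ineq66 T k C)
    (hLF : ∀ U : T.Cfg k, T.LF k U (fun h => -(T.mainT k h U) + T.Zterm k h) ≤ Real.exp (d * T.sites k))
    (U : T.Cfg k) : T.ρ k U ≤ Real.exp ((C + d) * T.sites k) := by
  have h1 := h66 U
  have h2 : T.LF k U (fun h => -(T.mainT k h U) + T.Zterm k h + C * T.sites k)
      = Real.exp (C * T.sites k) * T.LF k U (fun h => -(T.mainT k h U) + T.Zterm k h) := T.lf_shift k U _ _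
  rw [h2] at h1
  calc T.ρ k U ≤ Real.exp (C * T.sites k) * T.LF k U (fun h => -(T.mainT k h U) + T.Zterm k h) := h1
    _ ≤ Real.exp (C * T.sites k) * Real.exp (d * T.sites k) :=
        mul_le_mul_of_nonneg_left (hLF U) (Real.exp_pos _).le
    _ = Real.exp ((C + d) * T.sites k) := by rw [← Real.exp_add]; ring_nf

end Literature.MathematicalPhysics.QuantumFieldTheory.Balaban1985CMP102.SectD
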